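import Summits.QuantumFields.YangMills.Theorems.BalabanLadderIRcofEquipartitionSeamSliceKernelAssemble
import HarnessLib

/-!
# Crux `IRcof` (stmt-QuantumFields-26930) · line `equipartition_seam` (row 47) · located stub L `SpectralDict.SliceRealisationV` — helper:
# the gauge-averaged SLICE KERNEL of a GENERAL weight, F4 ∕ 7 — §8 the twisted plaquette weight of an assembled configuration layer by layer, §9 the electric family `withEl π z₀ e` (magnetic slice weight `magW`, electric link twist `elTwist`, the layered form of `secZ`), §10 the glue `a := √magW` and the (Z) clause at the concrete slice data

SOURCE OF RECORD: `Cruxes/IRcof/Lines/equipartition_seam_SliceKernel.lean` rev 9 (crux write 148dcb46cebb, 2172 l.; author ideator ym-ir-idea-22 g7; critic ym-ir-crit-3 g5 TYPEREADs CLEAN of revs 1–6 (bus l.1748 ∕ 1758 ∕ 1768 ∕ 1775 ∕ 1780), placement ruling H1 ∕ H2 (l.1748: §1 → Literature = lit-4 L34 p694639; §2 onward → ≤ 400-line Theorems files) — split VERBATIM along its §§ by LEAD prover ym-ir-line-ab-p1 g8 on the ideator's LAND-ASK H2 (bus l.1786 ∕ l.1789: files F1–F7, each importing the previous).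

HONEST FRAMING.  Elementary measure theory ∕ Fubini on compact groups (Lüscher 1977 ∕ Osterwalder–Seiler 1978 transfer-matrix positivity, weight-generic); proves NO located stub of row 47 by itself (S1, S3ʷ, T, L, N, S5ᵛ open); row 47 class PWP, mechanism 0, width 0; `IRcof` ∕ `IR` 0∕1; the Yang–Mills mass gap (Clay) is NOT proved by anything in this tree; R4 closes only the conditional finite-𝕋⁴ rung `BalabanLadder.UV`.
-/

noncomputable section

open MeasureTheory ProbabilityTheory Finset Filter Function
open scoped BigOperators

namespace Summit.QuantumFields.YangMills.Cruxes.IRcof.EquipartitionSeam.SliceKernel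

open Literature.Analysis.Matrix (IsPosDefKernel isPosDefKernel_const IsPosDefKernel.integral_prod_nonneg_of_measurable)
open Literature.MathematicalPhysics.QuantumFieldTheory (haarProbability integral_integral_fibreAverage_nonneg
  integrable_of_abs_le_one abs_mul_mul_le_one abs_integral_le_one)
open Literature.MathematicalPhysics.QuantumFieldTheory
open Summit.QuantumFields.YangMills.Cruxes.IRcof.EquipartitionSeam.KernelCurrency (sectorTensor withEl secZ secW)
open Literature.MathematicalPhysics.QuantumLattice (torusLift torusEdge)


/-! ## §8 The twisted plaquette weight of an assembled configuration, layer by layer -/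

section Layers

variable {m b₁ b₂ b₃ : ℕ} {H : Type*} [Group H]

/-- The spatial plaquette `(i, j)` at `p` of ONE slice `Vt`. -/
def slicePlaq (Vt : FinSpatialSite b₁ b₂ b₃ × Fin 3 → H) (p : FinSpatialSite b₁ b₂ b₃) (i j : Fin 3) : H :=
  Vt (p, i) * Vt (p.shift i, j) * (Vt (p.shift j, i))⁻¹ * (Vt (p, j))⁻¹

/-- The MAGNETIC weight of slice `t` under a plaquette-twist field `τ`: the product over the spatial sites and the three magnetic
planes of `w(τ_{(t,p), (i+1, j+1)} · spatial plaquette)`. -/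
def magWeight (w : H → ℝ) (τ : FinTorusSite m b₁ b₂ b₃ → Fin 4 → Fin 4 → H) (t : Fin m)
    (Vt : FinSpatialSite b₁ b₂ b₃ × Fin 3 → H) : ℝ :=
  ∏ p : FinSpatialSite b₁ b₂ b₃, ∏ q : SPlane, w (τ (t, p) q.1.1.succ q.1.2.succ * slicePlaq Vt p q.1.1 q.1.2)

/-- **Layer decomposition (any weight, any plaquette-twist field).**  The twisted plaquette weight of a time-first assembled
configuration is the product of the magnetic weights of the slices and, for each temporal layer `t`, the product over the
spatial links `l = (p, i)` of `w(τ_{(t,p),(0,i+1)} · E t p · V (t+1) l · (E t (p + eᵢ))⁻¹ · (V t l)⁻¹)`. -/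
theorem prod_plane_assembleZero (w : H → ℝ) (τ : FinTorusSite m b₁ b₂ b₃ → Fin 4 → Fin 4 → H)
    (VE : (Fin m → (FinSpatialSite b₁ b₂ b₃ × Fin 3 → H)) × (Fin m → (FinSpatialSite b₁ b₂ b₃ → H))) :
    ∏ x : FinTorusSite m b₁ b₂ b₃, ∏ q : Plane,
        w (τ x q.1.1 q.1.2 * finTorusPlaquette (assembleZero VE) x q.1.1 q.1.2) =
      (∏ t, magWeight w τ t (VE.1 t)) *
        ∏ t, ∏ p : FinSpatialSite b₁ b₂ b₃, ∏ i : Fin 3, w (τ (t, p) 0 i.succ *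
          (VE.2 t p * VE.1 (finRotate m t) (p, i) * (VE.2 t (p.shift i))⁻¹ * (VE.1 t (p, i))⁻¹)) := by
  rw [← Finset.prod_mul_distrib, Fintype.prod_prod_type]
  refine Finset.prod_congr rfl fun t _ => ?_
  rw [magWeight, ← Finset.prod_mul_distrib]
  refine Finset.prod_congr rfl fun p _ => ?_
  rw [prod_plane_eq_electric_mul_magnetic
      (fun μ ν => w (τ (t, p) μ ν * finTorusPlaquette (assembleZero VE) (t, p) μ ν)), mul_comm]
  simp only [finTorusPlaquette_assembleZero_zero_succ, finTorusPlaquette_assembleZero_succ_succ, slicePlaq]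

/-- A conjugation-invariant weight is cyclic: `w (g h) = w (h g)`. -/
theorem weight_mul_comm (w : H → ℝ) (hcl : ∀ g h : H, w (g * h * g⁻¹) = w h) (g h : H) : w (g * h) = w (h * g) := by
  have := hcl h (g * h)
  rw [← mul_assoc, mul_inv_cancel_right] at this  -- h * (g * h) * h⁻¹ = h * g
  exact this.symm

/-- **The temporal layer as the temporal kernel word.**  For a conjugation-invariant weight and CENTRAL electric twists,
`w(τ · E p · V' l · E(p')⁻¹ · (V l)⁻¹) = w((V l)⁻¹ · E p · (τ V' l) · E(p')⁻¹)` — the integrand of `tempKernel` (§2) with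
`src l = p`, `tgt l = p + eᵢ` and the twist moved onto the later slice. -/
theorem weight_twisted_temporal_eq (w : H → ℝ) (hcl : ∀ g h : H, w (g * h * g⁻¹) = w h) {τ E V' E' V : H}
    (hτ : τ ∈ Subgroup.center H) :
    w (τ * (E * V' * E'⁻¹ * V⁻¹)) = w (V⁻¹ * E * (τ * V') * E'⁻¹) := by
  have hc := Subgroup.mem_center_iff.mp hτ
  calc w (τ * (E * V' * E'⁻¹ * V⁻¹)) = w ((τ * (E * V' * E'⁻¹)) * V⁻¹) := by simp only [mul_assoc]
    _ = w (V⁻¹ * (τ * (E * V' * E'⁻¹))) := weight_mul_comm w hcl _ _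
    _ = w (V⁻¹ * E * (τ * V') * E'⁻¹) := by
        congr 1
        simp only [mul_assoc]
        rw [← mul_assoc τ E, ← hc E, mul_assoc E τ]

end Layers


section TempLayer

variable {m b₁ b₂ b₃ : ℕ} {P Λ H : Type*} [Fintype P] [Fintype Λ] [Group H]

/-- **The temporal layer IS the temporal kernel word** (§2 `tempKernel` with `src l = l.1`, `tgt l = l.1 + e_{l.2}`), the electric
twists of layer `t` moved onto the later slice as a `ctwist`: for a conjugation-invariant weight and central electric twists. -/
theorem prod_temporal_eq_tempKernel (w : H → ℝ) (hcl : ∀ g h : H, w (g * h * g⁻¹) = w h)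
    (τ : FinTorusSite m b₁ b₂ b₃ → Fin 4 → Fin 4 → H) (hτ : ∀ t p i, τ (t, p) 0 (Fin.succ i) ∈ Subgroup.center H)
    (VE : (Fin m → (FinSpatialSite b₁ b₂ b₃ × Fin 3 → H)) × (Fin m → (FinSpatialSite b₁ b₂ b₃ → H))) (t : Fin m) :
    ∏ p : FinSpatialSite b₁ b₂ b₃, ∏ i : Fin 3, w (τ (t, p) 0 i.succ *
        (VE.2 t p * VE.1 (finRotate m t) (p, i) * (VE.2 t (p.shift i))⁻¹ * (VE.1 t (p, i))⁻¹)) =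
      tempKernel Prod.fst (fun l : FinSpatialSite b₁ b₂ b₃ × Fin 3 => l.1.shift l.2) w (VE.1 t) (VE.2 t)
        (ctwist (fun l => τ (t, l.1) 0 l.2.succ) (VE.1 (finRotate m t))) := by
  rw [← Fintype.prod_prod_type']
  unfold tempKernel
  refine Finset.prod_congr rfl fun l _ => ?_
  rw [weight_twisted_temporal_eq w hcl (hτ t l.1 l.2)]
  rfl

end TempLayer

/-! ## §9 The electric family `withEl π z₀ e`: magnetic weight of a slice, electric link twist, the layered form of `secZ` -/

section Electric

variable {m b₁ b₂ b₃ : ℕ} {G H : Type} [Group G] [Group H] (π : H →* G)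

/-- Spatial coordinate `i` of a spatial site, as a natural number. -/
def spCoord (p : FinSpatialSite b₁ b₂ b₃) (i : Fin 3) : ℕ := ![(p.1 : ℕ), (p.2.1 : ℕ), (p.2.2 : ℕ)] i

omit [Group G] [Group H] in
/-- Auxiliary `finTorusSiteCoord_mk_zero` of the slice-kernel port (its statement is its type; rôle explained in the module ∕ section docstrings). -/
theorem finTorusSiteCoord_mk_zero (t : Fin m) (p : FinSpatialSite b₁ b₂ b₃) :
    finTorusSiteCoord ((t, p) : FinTorusSite m b₁ b₂ b₃) 0 = (t : ℕ) := rfl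

omit [Group G] [Group H] in
/-- Auxiliary `finTorusSiteCoord_mk_succ` of the slice-kernel port (its statement is its type; rôle explained in the module ∕ section docstrings). -/
theorem finTorusSiteCoord_mk_succ (t : Fin m) (p : FinSpatialSite b₁ b₂ b₃) (i : Fin 3) :
    finTorusSiteCoord ((t, p) : FinTorusSite m b₁ b₂ b₃) i.succ = spCoord p i := by
  fin_cases i <;> rfl

/-- **Electric entries** of the twist tensor of `withEl π z₀ e`: `e i` on the stack `{t = 0, p_i = 0}` of `(0, i+1)`-plaquettes. -/
theorem twistTensor_withEl_electric (z₀ : Sector π) (e : Fin 3 → ↥π.ker) (t : Fin m) (p : FinSpatialSite b₁ b₂ b₃)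
    (i : Fin 3) :
    tHooftTwistTensor (sectorTensor π (withEl π z₀ e)) ((t, p) : FinTorusSite m b₁ b₂ b₃) 0 i.succ =
      if (t : ℕ) = 0 ∧ spCoord p i = 0 then ((e i : ↥π.ker) : H) else 1 := by
  have hw : withEl π z₀ e ⟨((0 : Fin 4), i.succ), Fin.succ_pos i⟩ = e i := by
    simp only [withEl, if_true]
    congr 1
  simp only [tHooftTwistTensor, finTorusSiteCoord_mk_zero, finTorusSiteCoord_mk_succ, sectorTensor, Fin.succ_pos,
    dif_pos, hw]

/-- **Magnetic entries** of the twist tensor of `withEl π z₀ e`: independent of `e` AND of the time `t` (every slice carries the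
magnetic twist of `z₀` on the line `{p_i = p_j = 0}`). -/
theorem twistTensor_withEl_magnetic (z₀ : Sector π) (e : Fin 3 → ↥π.ker) (t : Fin m) (p : FinSpatialSite b₁ b₂ b₃)
    (i j : Fin 3) :
    tHooftTwistTensor (sectorTensor π (withEl π z₀ e)) ((t, p) : FinTorusSite m b₁ b₂ b₃) i.succ j.succ =
      if spCoord p i = 0 ∧ spCoord p j = 0 then sectorTensor π z₀ i.succ j.succ else 1 := by
  have hs : sectorTensor π (withEl π z₀ e) i.succ j.succ = sectorTensor π z₀ i.succ j.succ := by
    simp only [sectorTensor, withEl, Fin.succ_ne_zero, if_false]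
  simp only [tHooftTwistTensor, finTorusSiteCoord_mk_succ, hs]

/-- **Magnetic weight of ONE slice** in the sector `z₀` (the same for every member of `z₀`'s electric family and every time). -/
def magW (w : H → ℝ) (z₀ : Sector π) (V : FinSpatialSite b₁ b₂ b₃ × Fin 3 → H) : ℝ :=
  ∏ p : FinSpatialSite b₁ b₂ b₃, ∏ q : SPlane,
    w ((if spCoord p q.1.1 = 0 ∧ spCoord p q.1.2 = 0 then sectorTensor π z₀ q.1.1.succ q.1.2.succ else 1) *
      slicePlaq V p q.1.1 q.1.2)

/-- Auxiliary `magWeight_withEl` of the slice-kernel port (its statement is its type; rôle explained in the module ∕ section docstrings). -/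
theorem magWeight_withEl (w : H → ℝ) (z₀ : Sector π) (e : Fin 3 → ↥π.ker) (t : Fin m)
    (V : FinSpatialSite b₁ b₂ b₃ × Fin 3 → H) :
    magWeight w (tHooftTwistTensor (sectorTensor π (withEl π z₀ e)) : FinTorusSite m b₁ b₂ b₃ → Fin 4 → Fin 4 → H) t V =
      magW π w z₀ V := by
  simp only [magWeight, magW, twistTensor_withEl_magnetic]

/-- **Electric link twist** of `e`: `e i` on the spatial links `(p, i)` with `p_i = 0` (the seam `U_e` as a `ctwist`). -/
def elTwist (e : Fin 3 → ↥π.ker) : FinSpatialSite b₁ b₂ b₃ × Fin 3 → H :=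
  fun l => if spCoord l.1 l.2 = 0 then ((e l.2 : ↥π.ker) : H) else 1

/-- Auxiliary `elTwist_mem_center` of the slice-kernel port (its statement is its type; rôle explained in the module ∕ section docstrings). -/
theorem elTwist_mem_center (hker : π.ker ≤ Subgroup.center H) (e : Fin 3 → ↥π.ker)
    (l : FinSpatialSite b₁ b₂ b₃ × Fin 3) : elTwist π e l ∈ Subgroup.center H := by
  unfold elTwist
  split_ifs
  · exact hker (e l.2).2
  · exact Subgroup.one_mem _

/-- Auxiliary `twistTensor_withEl_electric_mem_center` of the slice-kernel port (its statement is its type; rôle explained in the module ∕ section docstrings). -/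
theorem twistTensor_withEl_electric_mem_center (hker : π.ker ≤ Subgroup.center H) (z₀ : Sector π)
    (e : Fin 3 → ↥π.ker) (t : Fin m) (p : FinSpatialSite b₁ b₂ b₃) (i : Fin 3) :
    tHooftTwistTensor (sectorTensor π (withEl π z₀ e)) ((t, p) : FinTorusSite m b₁ b₂ b₃) 0 (Fin.succ i) ∈
      Subgroup.center H := by
  rw [twistTensor_withEl_electric π z₀ e t p i]
  split_ifs
  · exact hker (e i).2
  · exact Subgroup.one_mem _

/-- **LAYERED FORM of the twisted plaquette weight of `withEl π z₀ e`** on the box with `1 + M + 1` time slices: magnetic slice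
weights × ONE electrically twisted temporal layer `0 → 1` (twist `elTwist π e` on slice `1`) × `M + 1` untwisted layers
`t+1 → t+2` (cyclically) — literally the integrand of §5 `integral_layers_eq_integral_iterate` with `a² = magW`. -/
theorem prod_plane_assembleZero_withEl (w : H → ℝ) (hcl : ∀ g h : H, w (g * h * g⁻¹) = w h)
    (hker : π.ker ≤ Subgroup.center H) (z₀ : Sector π) (e : Fin 3 → ↥π.ker) (M : ℕ)
    (VE : (Fin (1 + M + 1) → (FinSpatialSite b₁ b₂ b₃ × Fin 3 → H)) ×
      (Fin (1 + M + 1) → (FinSpatialSite b₁ b₂ b₃ → H))) :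
    ∏ x : FinTorusSite (1 + M + 1) b₁ b₂ b₃, ∏ q : Plane,
        w (tHooftTwistTensor (sectorTensor π (withEl π z₀ e)) x q.1.1 q.1.2 *
          finTorusPlaquette (assembleZero VE) x q.1.1 q.1.2) =
      (∏ t, magW π w z₀ (VE.1 t)) *
        (tempKernel Prod.fst (fun l : FinSpatialSite b₁ b₂ b₃ × Fin 3 => l.1.shift l.2) w (VE.1 0) (VE.2 0)
            (ctwist (elTwist π e) (VE.1 1)) *
          ∏ t : Fin (1 + M), tempKernel Prod.fst (fun l : FinSpatialSite b₁ b₂ b₃ × Fin 3 => l.1.shift l.2) w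
            (VE.1 t.succ) (VE.2 t.succ) (VE.1 (t.succ + 1))) := by
  rw [prod_plane_assembleZero]
  simp only [magWeight_withEl]
  congr 1
  simp_rw [prod_temporal_eq_tempKernel w hcl _ (twistTensor_withEl_electric_mem_center π hker z₀ e) VE]
  rw [Fin.prod_univ_succ]
  congr 1
  · congr 1
    funext l
    simp only [ctwist, twistTensor_withEl_electric, elTwist, Fin.val_zero, true_and, finRotate_apply, zero_add]
  · refine Finset.prod_congr rfl fun t _ => ?_
    congr 1
    funext l
    simp only [ctwist, twistTensor_withEl_electric, Fin.val_succ, Nat.succ_ne_zero, false_and, if_false, one_mul,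
      finRotate_apply]

end Electric

/-! ### `secZ` in layered form -/

section SecZ

variable {G H : Type} [Group G] [Group H] [TopologicalSpace H] [IsTopologicalGroup H] [CompactSpace H] [MeasurableSpace H]
  [BorelSpace H] [SecondCountableTopology H] (π : H →* G)

/-- **`Z_w(withEl z₀ e; (M+2) × (2S+1)³)` AS A LAYERED SLICE INTEGRAL** — the weight-generic time-first re-indexing half of L's (Z)
clause: `secZ` equals the integral over (`1+M+1` spatial slices) × (`1+M+1` temporal layers) of §5's layered integrand with
`a² = magW π w z₀`, the electric seam `ctwist (elTwist π e)` on the bond `0 → 1`, `src = Prod.fst`, `tgt l = l.1 + e_{l.2}`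
(then §5 `integral_layers_eq_integral_iterate` turns the right-hand side into `∫ (κ^[M+1] K(·,x)) (T x) dμ`).
Note `secZ … (M + 2) = secZ … (1 + M + 1)` by `rw [show M + 2 = 1 + M + 1 by omega]`. -/
theorem secZ_withEl_eq_integral_layers (w : H → ℝ) (hw : Continuous w) (hcl : ∀ g h : H, w (g * h * g⁻¹) = w h)
    (hker : π.ker ≤ Subgroup.center H) (z₀ : Sector π) (e : Fin 3 → ↥π.ker) (S M : ℕ) :
    secZ π w (withEl π z₀ e) S (1 + M + 1) =
      ∫ q : (Fin (1 + M + 1) → (FinSpatialSite (2 * S + 1) (2 * S + 1) (2 * S + 1) × Fin 3 → H)) ×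
          (Fin (1 + M + 1) → (FinSpatialSite (2 * S + 1) (2 * S + 1) (2 * S + 1) → H)),
        (∏ t, magW π w z₀ (q.1 t)) *
          (tempKernel Prod.fst (fun l : FinSpatialSite (2 * S + 1) (2 * S + 1) (2 * S + 1) × Fin 3 => l.1.shift l.2) w
              (q.1 0) (q.2 0) (ctwist (elTwist π e) (q.1 1)) *
            ∏ t : Fin (1 + M), tempKernel Prod.fst
              (fun l : FinSpatialSite (2 * S + 1) (2 * S + 1) (2 * S + 1) × Fin 3 => l.1.shift l.2) w
              (q.1 t.succ) (q.2 t.succ) (q.1 (t.succ + 1)))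
      ∂((Measure.pi fun _ => Measure.pi fun _ : FinSpatialSite (2 * S + 1) (2 * S + 1) (2 * S + 1) × Fin 3 =>
            haarProbability H).prod
          (Measure.pi fun _ => Measure.pi fun _ : FinSpatialSite (2 * S + 1) (2 * S + 1) (2 * S + 1) =>
            haarProbability H)) := by
  have hΦ : Measurable fun U : FinTorusSite (1 + M + 1) (2 * S + 1) (2 * S + 1) (2 * S + 1) × Fin 4 → H =>
      ∏ x : FinTorusSite (1 + M + 1) (2 * S + 1) (2 * S + 1) (2 * S + 1), ∏ q : Plane,
        w (tHooftTwistTensor (sectorTensor π (withEl π z₀ e)) x q.1.1 q.1.2 * finTorusPlaquette U x q.1.1 q.1.2) := by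
    refine Continuous.measurable (continuous_finsetProd _ fun x _ => continuous_finsetProd _ fun q _ =>
      hw.comp (continuous_const.mul ?_))
    unfold finTorusPlaquette
    fun_prop
  unfold secZ
  rw [integral_pi_eq_integral_assembleZero (haarProbability H) hΦ]
  refine integral_congr_ae (Eventually.of_forall fun q => ?_)
  exact prod_plane_assembleZero_withEl π w hcl hker z₀ e M q

end SecZ


/-! ## §10 The glue `a := √(magW)`: non-negativity, bound, continuity, invariance under the electric seam -/

section Glue

variable {b₁ b₂ b₃ : ℕ} {G H : Type} [Group G] [Group H] (π : H →* G)

omit [Group G] [Group H] in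
/-- Shifting a spatial site along `i` does not change its `j`-th coordinate, `j ≠ i`. -/
theorem spCoord_shift_of_ne (p : FinSpatialSite b₁ b₂ b₃) {i j : Fin 3} (h : i ≠ j) :
    spCoord (p.shift i) j = spCoord p j := by
  fin_cases i <;> fin_cases j <;> first | exact (h rfl).elim | rfl

/-- The electric link twist is FLAT on spatial plaquettes: `elTwist (p + eᵢ, j) = elTwist (p, j)` for `i ≠ j`. -/
theorem elTwist_shift_of_ne (e : Fin 3 → ↥π.ker) (p : FinSpatialSite b₁ b₂ b₃) {i j : Fin 3} (h : i ≠ j) :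
    elTwist π e (p.shift i, j) = elTwist π e (p, j) := by
  simp only [elTwist, spCoord_shift_of_ne p h]

/-- The seam of `e⁻¹` is the inverse link field. -/
theorem elTwist_inv (e : Fin 3 → ↥π.ker) :
    (elTwist π e⁻¹ : FinSpatialSite b₁ b₂ b₃ × Fin 3 → H) = (elTwist π e)⁻¹ := by
  funext l
  simp only [elTwist, Pi.inv_apply]
  split_ifs <;> simp

omit [Group G] in
/-- Pulling a central element out to the left. -/
theorem central_mul_left_comm {z : H} (hz : z ∈ Subgroup.center H) (x y : H) : x * (z * y) = z * (x * y) := by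
  rw [← mul_assoc, Subgroup.mem_center_iff.mp hz x, mul_assoc]

omit [Group G] in
/-- A plaquette word is blind to a flat central twist: `(z₁A)(z₂B)(z₁C)⁻¹(z₂D)⁻¹ = A B C⁻¹ D⁻¹` for central `z₁, z₂`. -/
theorem plaqWord_central_twist {z₁ z₂ : H} (hz₁ : z₁ ∈ Subgroup.center H) (hz₂ : z₂ ∈ Subgroup.center H)
    (A B C D : H) : z₁ * A * (z₂ * B) * (z₁ * C)⁻¹ * (z₂ * D)⁻¹ = A * B * C⁻¹ * D⁻¹ := by
  have hz₁' : z₁⁻¹ ∈ Subgroup.center H := Subgroup.inv_mem _ hz₁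
  have hz₂' : z₂⁻¹ ∈ Subgroup.center H := Subgroup.inv_mem _ hz₂
  simp only [mul_inv_rev, mul_assoc]
  rw [central_mul_left_comm hz₂ A, central_mul_left_comm hz₁' C⁻¹, central_mul_left_comm hz₁' B,
    central_mul_left_comm hz₁' A, Subgroup.mem_center_iff.mp hz₂' D⁻¹, central_mul_left_comm hz₂' C⁻¹,
    central_mul_left_comm hz₂' B, central_mul_left_comm hz₂' A, ← central_mul_left_comm hz₁ z₂, mul_inv_cancel_left,
    mul_inv_cancel_left]

/-- Spatial plaquettes are blind to the electric seam: `slicePlaq (elTwist • V) = slicePlaq V` on the planes `i ≠ j`. -/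
theorem slicePlaq_ctwist_elTwist (hker : π.ker ≤ Subgroup.center H) (e : Fin 3 → ↥π.ker)
    (V : FinSpatialSite b₁ b₂ b₃ × Fin 3 → H) (p : FinSpatialSite b₁ b₂ b₃) {i j : Fin 3} (h : i ≠ j) :
    slicePlaq (ctwist (elTwist π e) V) p i j = slicePlaq V p i j := by
  simp only [slicePlaq, ctwist, elTwist_shift_of_ne π e p h, elTwist_shift_of_ne π e p (Ne.symm h)]
  exact plaqWord_central_twist (elTwist_mem_center π hker e (p, i)) (elTwist_mem_center π hker e (p, j)) _ _ _ _

/-- **The magnetic slice weight is invariant under the electric seam** (`a ∘ ctwist (elTwist e) = a` of §5). -/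
theorem magW_ctwist_elTwist (w : H → ℝ) (hker : π.ker ≤ Subgroup.center H) (z₀ : Sector π) (e : Fin 3 → ↥π.ker)
    (V : FinSpatialSite b₁ b₂ b₃ × Fin 3 → H) : magW π w z₀ (ctwist (elTwist π e) V) = magW π w z₀ V := by
  unfold magW
  refine Finset.prod_congr rfl fun p _ => Finset.prod_congr rfl fun q _ => ?_
  rw [slicePlaq_ctwist_elTwist π hker e V p (ne_of_lt q.2)]

/-- Auxiliary `magW_nonneg` of the slice-kernel port (its statement is its type; rôle explained in the module ∕ section docstrings). -/
theorem magW_nonneg (w : H → ℝ) (hw0 : ∀ h, 0 ≤ w h) (z₀ : Sector π) (V : FinSpatialSite b₁ b₂ b₃ × Fin 3 → H) :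
    0 ≤ magW π w z₀ V :=
  Finset.prod_nonneg fun _ _ => Finset.prod_nonneg fun _ _ => hw0 _

/-- Auxiliary `magW_le` of the slice-kernel port (its statement is its type; rôle explained in the module ∕ section docstrings). -/
theorem magW_le (w : H → ℝ) (hw0 : ∀ h, 0 ≤ w h) {Cw : ℝ} (hwC : ∀ h, w h ≤ Cw) (z₀ : Sector π)
    (V : FinSpatialSite b₁ b₂ b₃ × Fin 3 → H) :
    magW π w z₀ V ≤ (Cw ^ Fintype.card SPlane) ^ Fintype.card (FinSpatialSite b₁ b₂ b₃) := by
  unfold magW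
  calc _ ≤ ∏ _p : FinSpatialSite b₁ b₂ b₃, Cw ^ Fintype.card SPlane :=
        Finset.prod_le_prod (fun _ _ => Finset.prod_nonneg fun _ _ => hw0 _) fun p _ =>
          (Finset.prod_le_prod (fun _ _ => hw0 _) fun _ _ => hwC _).trans
            (by rw [Finset.prod_const, Finset.card_univ])
    _ = _ := by rw [Finset.prod_const, Finset.card_univ]

/-- `a := √(magW)` squares back to the magnetic weight. -/
theorem sq_sqrt_magW (w : H → ℝ) (hw0 : ∀ h, 0 ≤ w h) (z₀ : Sector π) (V : FinSpatialSite b₁ b₂ b₃ × Fin 3 → H) :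
    Real.sqrt (magW π w z₀ V) ^ 2 = magW π w z₀ V :=
  Real.sq_sqrt (magW_nonneg π w hw0 z₀ V)

/-- Auxiliary `abs_sqrt_magW_le` of the slice-kernel port (its statement is its type; rôle explained in the module ∕ section docstrings). -/
theorem abs_sqrt_magW_le (w : H → ℝ) (hw0 : ∀ h, 0 ≤ w h) {Cw : ℝ} (hwC : ∀ h, w h ≤ Cw) (z₀ : Sector π)
    (V : FinSpatialSite b₁ b₂ b₃ × Fin 3 → H) :
    |Real.sqrt (magW π w z₀ V)| ≤ Real.sqrt ((Cw ^ Fintype.card SPlane) ^ Fintype.card (FinSpatialSite b₁ b₂ b₃)) := by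
  rw [abs_of_nonneg (Real.sqrt_nonneg _)]
  exact Real.sqrt_le_sqrt (magW_le π w hw0 hwC z₀ V)

/-- Auxiliary `sqrt_magW_ctwist_elTwist` of the slice-kernel port (its statement is its type; rôle explained in the module ∕ section docstrings). -/
theorem sqrt_magW_ctwist_elTwist (w : H → ℝ) (hker : π.ker ≤ Subgroup.center H) (z₀ : Sector π)
    (e : Fin 3 → ↥π.ker) (V : FinSpatialSite b₁ b₂ b₃ × Fin 3 → H) :
    Real.sqrt (magW π w z₀ (ctwist (elTwist π e) V)) = Real.sqrt (magW π w z₀ V) := by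
  rw [magW_ctwist_elTwist π w hker z₀ e V]

variable [TopologicalSpace H] [IsTopologicalGroup H]

/-- The magnetic slice weight is continuous in the slice (continuous `w`). -/
theorem continuous_magW (w : H → ℝ) (hw : Continuous w) (z₀ : Sector π) :
    Continuous (magW π w z₀ : (FinSpatialSite b₁ b₂ b₃ × Fin 3 → H) → ℝ) := by
  unfold magW slicePlaq
  refine continuous_finsetProd _ fun p _ => continuous_finsetProd _ fun q _ => hw.comp (continuous_const.mul ?_)
  fun_prop

/-- Auxiliary `measurable_sqrt_magW` of the slice-kernel port (its statement is its type; rôle explained in the module ∕ section docstrings). -/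
theorem measurable_sqrt_magW [MeasurableSpace H] [BorelSpace H] [SecondCountableTopology H] (w : H → ℝ)
    (hw : Continuous w) (z₀ : Sector π) :
    Measurable fun V : FinSpatialSite b₁ b₂ b₃ × Fin 3 → H => Real.sqrt (magW π w z₀ V) :=
  (Real.continuous_sqrt.comp (continuous_magW π w hw z₀)).measurable

end Glue

/-! ### The (Z) clause of L, assembled: `secZ = ∫ (κ^[M+1] K(·,x)) (T_e x) dμ` -/

section ZClause

variable {G H : Type} [Group G] [Group H] [TopologicalSpace H] [IsTopologicalGroup H] [CompactSpace H] [MeasurableSpace H]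
  [BorelSpace H] [SecondCountableTopology H] (π : H →* G)

/-- **THE (Z) CLAUSE OF L** for the concrete slice data `X := FinSpatialSite (2S+1)³ × Fin 3 → H`, `μ := ⊗Haar`,
`K := sandKernel Prod.fst (l ↦ l.1 + e_{l.2}) w √(magW π w z₀ ·)`, `T e := ctwist (elTwist π e⁻¹)`:
`Z_w(withEl z₀ e; (M+2) × (2S+1)³) = ∫ (κ^[M+1] K(·, x)) (T e x) dμ(x)` for every `M` — §9 (time-first re-indexing) ∘ §10 (glue)
∘ §5 (abstract cyclic chain ∘ Literature `integral_cyclic_twisted_eq_integral_iterate`).  Hypotheses: `w` continuous,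
`0 ≤ w ≤ Cw`, conjugation-invariant (clauses of `TwistSplitWeight`), `ker π ≤ centre`. [cite: Luscher1977] [cite: tHooft1979Flux] -/
theorem secZ_withEl_eq_integral_iterate (w : H → ℝ) (hw : Continuous w) (hw0 : ∀ h, 0 ≤ w h) {Cw : ℝ}
    (hwC : ∀ h, w h ≤ Cw) (hcl : ∀ g h : H, w (g * h * g⁻¹) = w h) (hker : π.ker ≤ Subgroup.center H)
    (z₀ : Sector π) (e : Fin 3 → ↥π.ker) (S M : ℕ) :
    secZ π w (withEl π z₀ e) S (M + 2) =
      ∫ x, ((fun f : (FinSpatialSite (2 * S + 1) (2 * S + 1) (2 * S + 1) × Fin 3 → H) → ℝ => fun u =>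
          ∫ y, sandKernel Prod.fst (fun l : FinSpatialSite (2 * S + 1) (2 * S + 1) (2 * S + 1) × Fin 3 => l.1.shift l.2) w
              (fun V => Real.sqrt (magW π w z₀ V)) u y * f y
            ∂(Measure.pi fun _ : FinSpatialSite (2 * S + 1) (2 * S + 1) (2 * S + 1) × Fin 3 => haarProbability H))^[M + 1]
          (fun y => sandKernel Prod.fst (fun l : FinSpatialSite (2 * S + 1) (2 * S + 1) (2 * S + 1) × Fin 3 => l.1.shift l.2) w
            (fun V => Real.sqrt (magW π w z₀ V)) y x)) (ctwist (elTwist π e⁻¹) x)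
        ∂(Measure.pi fun _ : FinSpatialSite (2 * S + 1) (2 * S + 1) (2 * S + 1) × Fin 3 => haarProbability H) := by
  rw [show M + 2 = 1 + M + 1 by omega, secZ_withEl_eq_integral_layers π w hw hcl hker z₀ e S M, elTwist_inv,
    ← integral_layers_eq_integral_iterate Prod.fst
      (fun l : FinSpatialSite (2 * S + 1) (2 * S + 1) (2 * S + 1) × Fin 3 => l.1.shift l.2) w
      (fun V => Real.sqrt (magW π w z₀ V)) hw hw0 hwC (measurable_sqrt_magW π w hw z₀)
      (abs_sqrt_magW_le π w hw0 hwC z₀) (elTwist_mem_center π hker e) (sqrt_magW_ctwist_elTwist π w hker z₀ e) M]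
  refine integral_congr_ae (Eventually.of_forall fun q => ?_)
  simp only [sq_sqrt_magW π w hw0 z₀]

end ZClause

end Summit.QuantumFields.YangMills.Cruxes.IRcof.EquipartitionSeam.SliceKernel

end
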